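import Literature.MathematicalPhysics.QuantumLattice.StrongCouplingBosonisation
import Literature.MathematicalPhysics.StatisticalMechanics.NJLExponentialClustering
import HarnessLib

/-!
# Exponential clustering of `ψ̄ψ` in strongly coupled lattice QED at nonzero mass
# (Salmhofer–Seiler, CMP 139 (1991), Thm. 3.11 with Remark 3.4 (1)–(2) and §2 (2.21), (2.24))

Salmhofer–Seiler, Summary p. 424: the new results include "(1) the proof of clustering … for QED and
the NJL-systems at nonzero mass (Theorem 3.11)"; Remark 3.4 (1), p. 404: for `N = 1` "the
`U(1)`-model, i.e. strongly coupled (compact or noncompact) lattice QED, is a NJL system"; and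
§2 (2.21)/(2.24) (Remark 3.4 (2)): the `β = 0` gauge theory with staggered fermions IS the complex
spin system, `⟨F(ψ̄ψ/2N)⟩_Λ = ⟨F(σ)⟩_Λ`.

This file puts the three together, with no named fact: for **strongly coupled (`β = 0`) lattice QED
with staggered fermions on the torus `(ℤ/Lℤ)^ν`** (honest Berezin–Haar integrals `fermiExpect` of
`StrongCouplingBosonisation`, any link signs `Γ² = 1`, in particular the staggered phases of
(2.4)), at every REAL mass `m ≠ 0`, the truncated two-point function of `ψ̄ψ/2` clusters
exponentially, uniformly in the volume, with the explicit rate and prefactor of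
`ComplexSpin.njl_abs_truncatedTwoPoint_le_real` (`NJLExponentialClustering`: Thm. 3.11 on the whole
mass region by the Joukowski parametrisation and the Schwarz lemma):

* `qed_twoPoint_clustering` — `|⟨(ψ̄ψ(x)/2)(ψ̄ψ(y)/2)⟩_Λ - ⟨ψ̄ψ(x)/2⟩_Λ⟨ψ̄ψ(y)/2⟩_Λ| ≤ C(r)(q(m)/r)^{2D}`
  for `x, y` at torus distance `≥ D` in a coordinate direction, `q(m) = √(2ν)/(|m| + √(m² + 2ν))`,
  any `r ∈ (q(m), 1)`, `C(r) = ComplexSpin.njlClusterConst ν r`, every `L > 1`;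
* `qed_twoPoint_exponentialClustering` — for every real `m ≠ 0`: `κ(m) > 0`, `C(m)` with
  `≤ C e^{-κ D}` in every volume;
* `qed_twoPoint_clustering_staggered` — the same for the staggered action itself (signs `Γ_μ(x)` of
  (2.4); `e^{-S_F} = exp(ψ̄(-D)ψ)` with the tree's `staggeredDirac`, `fermiBoltzmann_torus_eq_staggeredDirac`).

Scope: `N = 1` only ("the proof that clustering holds for nonzero mass has not been extended to the
`U(N)`-models for `N ≥ 2`", p. 420); `β = 0`, `g₄ = 0`, finite tori (uniformly) — nothing about
`β > 0`, the continuum, `SU(N)`, a mass gap or the summit's `QCD` conjunct.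

## References

* M. Salmhofer, E. Seiler, *Proof of chiral symmetry breaking in strongly coupled lattice gauge
  theory*, Commun. Math. Phys. 139 (1991) 395–432: Thm. 3.11, Remark 3.4 (1)–(2), (2.21), (2.24),
  Summary (1) p. 424. [SalmhoferSeiler1991]
* M. Salmhofer, E. Seiler, Erratum, Commun. Math. Phys. 146 (1992) 637–638. [SalmhoferSeiler1992Erratum]
-/

noncomputable section

namespace Literature.MathematicalPhysics.QuantumLattice

namespace StrongCoupling

open MvPolynomial
open Literature.Probability.LatticeModels (TorusSite Site)
open Literature.Probability.LatticeModels
open Literature.MathematicalPhysics.StatisticalMechanics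
open Literature.MathematicalPhysics.StatisticalMechanics.ComplexSpin

variable {ν : ℕ}

/-- The two-site monomial read on the torus is `σ_{x̄} σ_{ȳ}`. [cite: SalmhoferSeiler1991, (3.30)] -/
private theorem monomial_mapDomain_pair (L : ℕ) [NeZero L] (x y : Site ν) :
    (monomial (Finsupp.mapDomain (Torus.proj L) (Finsupp.single x 1 + Finsupp.single y 1)) (1 : ℝ) :
        MvPolynomial (TorusSite ν L) ℝ) = X (Torus.proj L x) * X (Torus.proj L y) := by
  rw [Finsupp.mapDomain_add, Finsupp.mapDomain_single, Finsupp.mapDomain_single, X, X,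
    monomial_mul, mul_one]

/-- The one-site monomial read on the torus is `σ_{x̄}`. [cite: SalmhoferSeiler1991, (3.30)] -/
private theorem monomial_mapDomain_single (L : ℕ) [NeZero L] (x : Site ν) :
    (monomial (Finsupp.mapDomain (Torus.proj L) (Finsupp.single x 1)) (1 : ℝ) :
        MvPolynomial (TorusSite ν L) ℝ) = X (Torus.proj L x) := by
  rw [Finsupp.mapDomain_single, X]

/-- **Exponential clustering of `ψ̄ψ` in strongly coupled lattice QED at real nonzero mass, every
volume** (Thm. 3.11 + Remark 3.4 (1) + (2.21)): for `β = 0` `U(1)` lattice gauge theory with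
staggered fermions on `(ℤ/Lℤ)^ν` (`ν ≥ 1`, `L > 1`, any linear order of the sites, any link signs
`Γ² = 1`), real `m ≠ 0`, lattice points `x, y` at torus distance `≥ D ≥ 1` in direction `i`
(`D ≤ |x_i - y_i|`, `|x_i - y_i| + D ≤ L`), and `q(m) = √(2ν)/(|m| + √(m² + 2ν)) < r < 1`:
`|⟨(ψ̄ψ(x̄)/2)(ψ̄ψ(ȳ)/2)⟩_Λ - ⟨ψ̄ψ(x̄)/2⟩_Λ ⟨ψ̄ψ(ȳ)/2⟩_Λ| ≤ C(r) (q(m)/r)^{2D}`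
(`spinObs (X x̄) = ψ̄ψ(x̄)/2`, `spinObs_X`; `C = ComplexSpin.njlClusterConst`). [cite: SalmhoferSeiler1991, Thm. 3.11, Remark 3.4 (1)–(2) and (2.21)][cite: SalmhoferSeiler1992Erratum, (5)] -/
theorem qed_twoPoint_clustering (hν : 1 ≤ ν) {L : ℕ} [NeZero L] [LinearOrder (TorusSite ν L)]
    (hL1 : 1 < L) (Γ : TorusSite ν L × Fin ν → ℂ) (hΓ : ∀ b, Γ b ^ 2 = 1)
    {x y : Site ν} {i : Fin ν} {D : ℕ} (hD1 : 1 ≤ D) (hD : (D : ℤ) ≤ |x i - y i|)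
    (hL : |x i - y i| + (D : ℤ) ≤ L) {m : ℝ} (hm : m ≠ 0) {r : ℝ} (hr : r < 1)
    (hqr : Real.sqrt (2 * ν) / (|m| + Real.sqrt (m ^ 2 + 2 * ν)) < r) :
    ‖fermiExpect (torusLinks ν L) Γ (m : ℂ)
          (fun _ => (spinObs (X (Torus.proj L x) * X (Torus.proj L y)) : FermiAlg (TorusSite ν L) 1)) -
        fermiExpect (torusLinks ν L) Γ (m : ℂ)
            (fun _ => (spinObs (X (Torus.proj L x)) : FermiAlg (TorusSite ν L) 1)) *
          fermiExpect (torusLinks ν L) Γ (m : ℂ)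
            (fun _ => (spinObs (X (Torus.proj L y)) : FermiAlg (TorusSite ν L) 1))‖ ≤
      njlClusterConst ν r * (Real.sqrt (2 * ν) / (|m| + Real.sqrt (m ^ 2 + 2 * ν)) / r) ^ (2 * D) := by
  have key := njl_abs_truncatedTwoPoint_le_real (ν := ν) (N := 1) le_rfl hν hD1 hD hL hm hr hqr
  rw [fermiExpect_spinObs hL1 Γ hΓ m, fermiExpect_spinObs hL1 Γ hΓ m, fermiExpect_spinObs hL1 Γ hΓ m,
    expect_uN_one_eq_njl, expect_uN_one_eq_njl, expect_uN_one_eq_njl, ← Complex.ofReal_mul,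
    ← Complex.ofReal_sub, Complex.norm_real, Real.norm_eq_abs, ← monomial_mapDomain_pair L x y,
    ← monomial_mapDomain_single L x, ← monomial_mapDomain_single L y]
  exact key

/-- The same bound written with the meson operators `ψ̄ψ(x̄) = ∑_a ψ̄_a(x̄)ψ_a(x̄)` (`N = 1`):
`|⟨(½ψ̄ψ(x̄))(½ψ̄ψ(ȳ))⟩_Λ - ⟨½ψ̄ψ(x̄)⟩_Λ⟨½ψ̄ψ(ȳ)⟩_Λ| ≤ C(r)(q(m)/r)^{2D}`. [cite: SalmhoferSeiler1991, Thm. 3.11 and (2.24)] -/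
theorem qed_mesonTwoPoint_clustering (hν : 1 ≤ ν) {L : ℕ} [NeZero L] [LinearOrder (TorusSite ν L)]
    (hL1 : 1 < L) (Γ : TorusSite ν L × Fin ν → ℂ) (hΓ : ∀ b, Γ b ^ 2 = 1)
    {x y : Site ν} {i : Fin ν} {D : ℕ} (hD1 : 1 ≤ D) (hD : (D : ℤ) ≤ |x i - y i|)
    (hL : |x i - y i| + (D : ℤ) ≤ L) {m : ℝ} (hm : m ≠ 0) {r : ℝ} (hr : r < 1)
    (hqr : Real.sqrt (2 * ν) / (|m| + Real.sqrt (m ^ 2 + 2 * ν)) < r) :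
    ‖fermiExpect (torusLinks ν L) Γ (m : ℂ)
          (fun _ => (((2 * (1 : ℕ) : ℂ)⁻¹ • meson (Torus.proj L x)) *
            ((2 * (1 : ℕ) : ℂ)⁻¹ • meson (Torus.proj L y)) : FermiAlg (TorusSite ν L) 1)) -
        fermiExpect (torusLinks ν L) Γ (m : ℂ)
            (fun _ => ((2 * (1 : ℕ) : ℂ)⁻¹ • meson (Torus.proj L x) : FermiAlg (TorusSite ν L) 1)) *
          fermiExpect (torusLinks ν L) Γ (m : ℂ)
            (fun _ => ((2 * (1 : ℕ) : ℂ)⁻¹ • meson (Torus.proj L y) : FermiAlg (TorusSite ν L) 1))‖ ≤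
      njlClusterConst ν r * (Real.sqrt (2 * ν) / (|m| + Real.sqrt (m ^ 2 + 2 * ν)) / r) ^ (2 * D) := by
  have key := qed_twoPoint_clustering hν hL1 Γ hΓ hD1 hD hL hm hr hqr
  rw [spinObs_X_mul_X, spinObs_X, spinObs_X] at key
  exact key

/-- **QED clustering at every real nonzero mass, exponential form**: for `ν ≥ 1` and real `m ≠ 0`
there are `κ(m) > 0` and `C(m) ≥ 0` such that in `β = 0` lattice QED with staggered fermions on
every torus `(ℤ/Lℤ)^ν` (`L > 1`, any link signs `Γ² = 1`),
`|⟨(ψ̄ψ(x̄)/2)(ψ̄ψ(ȳ)/2)⟩_Λ - ⟨ψ̄ψ(x̄)/2⟩_Λ⟨ψ̄ψ(ȳ)/2⟩_Λ| ≤ C e^{-κ D}` for all `x, y` at torus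
distance `≥ D` in a coordinate direction — "clustering for QED at nonzero mass" (Summary (1),
p. 424). [cite: SalmhoferSeiler1991, Thm. 3.11, Remark 3.4 (1) and Summary (1) p. 424][cite: SalmhoferSeiler1992Erratum, (1)] -/
theorem qed_twoPoint_exponentialClustering (hν : 1 ≤ ν) {m : ℝ} (hm : m ≠ 0) :
    ∃ κ : ℝ, 0 < κ ∧ ∃ C : ℝ, 0 ≤ C ∧
      ∀ (L : ℕ) [NeZero L] [LinearOrder (TorusSite ν L)], 1 < L →
        ∀ (Γ : TorusSite ν L × Fin ν → ℂ), (∀ b, Γ b ^ 2 = 1) →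
        ∀ (x y : Site ν) (i : Fin ν) (D : ℕ), 1 ≤ D → (D : ℤ) ≤ |x i - y i| →
          |x i - y i| + (D : ℤ) ≤ L →
          ‖fermiExpect (torusLinks ν L) Γ (m : ℂ)
                (fun _ => (spinObs (X (Torus.proj L x) * X (Torus.proj L y)) : FermiAlg (TorusSite ν L) 1)) -
              fermiExpect (torusLinks ν L) Γ (m : ℂ)
                  (fun _ => (spinObs (X (Torus.proj L x)) : FermiAlg (TorusSite ν L) 1)) *
                fermiExpect (torusLinks ν L) Γ (m : ℂ)
                  (fun _ => (spinObs (X (Torus.proj L y)) : FermiAlg (TorusSite ν L) 1))‖ ≤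
            C * Real.exp (-κ * D) := by
  have hmr : ((m : ℂ)).re ≠ 0 := by rwa [Complex.ofReal_re]
  obtain ⟨κ, hκ, C, hC0, h⟩ :=
    njl_twoPoint_exponentialClustering (ν := ν) (N := 1) le_rfl hν (m := (m : ℂ)) (Or.inl hmr)
  refine ⟨κ, hκ, C, hC0, fun L _ _ hL1 Γ hΓ x y i D hD1 hD hL => ?_⟩
  have key := h L x y i D hD1 hD hL
  rw [fermiExpect_spinObs hL1 Γ hΓ m, fermiExpect_spinObs hL1 Γ hΓ m, fermiExpect_spinObs hL1 Γ hΓ m,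
    expect_uN_one_eq_njl, expect_uN_one_eq_njl, expect_uN_one_eq_njl, ← monomial_mapDomain_pair L x y,
    ← monomial_mapDomain_single L x, ← monomial_mapDomain_single L y, ← njlCorrelation_ofReal,
    ← njlCorrelation_ofReal, ← njlCorrelation_ofReal]
  exact key

/-- **QED clustering for the staggered action itself** (signs `Γ_μ(x)` of (2.4), periodic links
`(x, x + e_μ)`; `e^{-S_F} = exp(ψ̄(-D)ψ)` for the tree's `staggeredDirac` by
`fermiBoltzmann_torus_eq_staggeredDirac`): at every real `m ≠ 0` the truncated `ψ̄ψ` two-point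
function decays exponentially in the torus distance, uniformly in the volume. [cite: SalmhoferSeiler1991, Thm. 3.11, (2.3)–(2.4) and Remark 3.4 (1)] -/
theorem qed_twoPoint_clustering_staggered (hν : 1 ≤ ν) {m : ℝ} (hm : m ≠ 0) :
    ∃ κ : ℝ, 0 < κ ∧ ∃ C : ℝ, 0 ≤ C ∧
      ∀ (L : ℕ) [NeZero L] [LinearOrder (TorusSite ν L)], 1 < L →
        ∀ (x y : Site ν) (i : Fin ν) (D : ℕ), 1 ≤ D → (D : ℤ) ≤ |x i - y i| →
          |x i - y i| + (D : ℤ) ≤ L →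
          ‖fermiExpect (torusLinks ν L) (fun p => ((staggeredPhase p.1 p.2 : ℤ) : ℂ)) (m : ℂ)
                (fun _ => (spinObs (X (Torus.proj L x) * X (Torus.proj L y)) : FermiAlg (TorusSite ν L) 1)) -
              fermiExpect (torusLinks ν L) (fun p => ((staggeredPhase p.1 p.2 : ℤ) : ℂ)) (m : ℂ)
                  (fun _ => (spinObs (X (Torus.proj L x)) : FermiAlg (TorusSite ν L) 1)) *
                fermiExpect (torusLinks ν L) (fun p => ((staggeredPhase p.1 p.2 : ℤ) : ℂ)) (m : ℂ)
                  (fun _ => (spinObs (X (Torus.proj L y)) : FermiAlg (TorusSite ν L) 1))‖ ≤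
            C * Real.exp (-κ * D) := by
  obtain ⟨κ, hκ, C, hC0, h⟩ := qed_twoPoint_exponentialClustering (ν := ν) hν hm
  exact ⟨κ, hκ, C, hC0, fun L _ _ hL1 x y i D hD1 hD hL =>
    h L hL1 _ (fun p => staggeredPhase_sq p.1 p.2) x y i D hD1 hD hL⟩

end StrongCoupling

end Literature.MathematicalPhysics.QuantumLattice
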